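/-
Copyright (c) 2026. All rights reserved.
Released under Apache 2.0 license as described in the file LICENSE.
Authors: abc-iut cell, statement-typer seat abc-iut-L4-t3 (wave 1).
-/
import Literature.AnabelianGeometry.AbsoluteAnabelian.ArithmeticLineBundles

/-!
# [AbsTopIII] Definition 5.3 (ii): coordinates on a `⊞`-line bundle (proof-only toolkit)

S. Mochizuki, *Topics in absolute anabelian geometry III* [MochizukiAbsTopIII2015], Def 5.3 (ii) pp. 123–124: the
assignment `L⊞[⊚] ↦` "the `(M⊚_{TLG})^Π`-torsor of nonzero sections of `L⊞[⊚] ⊗ (M⊚)^Π`" determines an equivalence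
of categories `Th⊚⊞_T ⥲ Th⊚⊠_T`. First step of the DISCHARGE of the named fact `AddMulLineBundleCategoriesEquivalent`
(`ArithmeticLineBundles.lean`, seat abc-iut-L4-t3): a rank-one torsion-free `𝒪_F`-module `L⊞[⊚]` with a chosen nonzero
element `x₀` embeds `𝒪_F`-linearly into `F` by a unique COORDINATE `c` with `c x₀ = 1` (so `L⊞[⊚] ⊗ F ≅ F` and the
nonzero sections are `F^× · x₀`); the Hermitian norms scale along `c` (`|y|_v = |c y|_v · |x₀|_v`); a morphism of
`⊞`-line bundles is determined by its value at `x₀` and multiplies coordinates by a nonzero constant. Proof-only (no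
new notions). Refereed pre-IUT material; nothing here bears on [IUTchIII] Cor. 3.12.
-/

set_option autoImplicit false

noncomputable section

open NumberField

namespace Literature.AnabelianGeometry.AbsoluteAnabelian

namespace AddLineBundle

variable {F : Type} [Field F]

/-- every element `y` of the rank-one module `L⊞[⊚]` is a FRACTION of a nonzero `x₀`: `t • y = s • x₀` with `t ≠ 0`.
[cite: MochizukiAbsTopIII2015, Def 5.3 (ii) p. 123] -/
theorem exists_rep (L : AddLineBundle F) {x₀ : L.L} (hx₀ : x₀ ≠ 0) (y : L.L) :
    ∃ s t : 𝓞 F, t ≠ 0 ∧ t • y = s • x₀ := by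
  obtain ⟨s, t, hst, h⟩ := L.exists_smul_add_smul_eq_zero y x₀
  have hs : s ≠ 0 := by
    rintro rfl
    rw [zero_smul, zero_add] at h
    exact hx₀ ((smul_eq_zero_iff_right (hst.resolve_left fun h0 => h0 rfl)).mp h)
  refine ⟨-t, s, hs, ?_⟩
  rw [neg_smul, eq_neg_iff_add_eq_zero, h]

/-- the fraction `s / t` of such a representation is well defined. [cite: MochizukiAbsTopIII2015, Def 5.3 (ii) p. 123] -/
theorem rep_div_eq (L : AddLineBundle F) {x₀ : L.L} (hx₀ : x₀ ≠ 0) {y : L.L} {s t s' t' : 𝓞 F} (ht : t ≠ 0)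
    (ht' : t' ≠ 0) (h : t • y = s • x₀) (h' : t' • y = s' • x₀) : (s : F) / t = s' / t' := by
  have h1 : (t' * s) • x₀ = (t * s') • x₀ := by
    rw [mul_smul, ← h, mul_smul, ← h', smul_comm]
  have h2 : t' * s = t * s' := smul_left_injective (𝓞 F) hx₀ h1
  have ht0 : (t : F) ≠ 0 := fun h0 => ht (RingOfIntegers.coe_eq_zero_iff.mp h0)
  have ht0' : (t' : F) ≠ 0 := fun h0 => ht' (RingOfIntegers.coe_eq_zero_iff.mp h0)
  rw [div_eq_div_iff ht0 ht0']
  have h3 := congrArg (fun z : 𝓞 F => (z : F)) h2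
  simp only [map_mul] at h3
  linear_combination h3

/-- a linear form with `c x₀ = 1` computes the fractions: `t • y = s • x₀ ⟹ c y = s / t`.
[cite: MochizukiAbsTopIII2015, Def 5.3 (ii) p. 123] -/
theorem coordinate_apply (L : AddLineBundle F) {x₀ : L.L} (c : L.L →ₗ[𝓞 F] F) (hc : c x₀ = 1) {y : L.L}
    {s t : 𝓞 F} (ht : t ≠ 0) (h : t • y = s • x₀) : c y = s / t := by
  have ht0 : (t : F) ≠ 0 := fun h0 => ht (RingOfIntegers.coe_eq_zero_iff.mp h0)
  have h1 : (t : F) * c y = s := by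
    have := congrArg c h
    rw [map_smul, map_smul, hc, Algebra.smul_def, Algebra.smul_def, mul_one] at this
    exact this
  rw [eq_div_iff ht0, mul_comm]
  exact h1

/-- EXISTENCE of the coordinate: an `𝒪_F`-linear form `c : L⊞[⊚] → F` with `c x₀ = 1` (the isomorphism
`L⊞[⊚] ⊗ F ≅ F` normalised at `x₀`). [cite: MochizukiAbsTopIII2015, Def 5.3 (ii) p. 123] -/
theorem exists_coordinate (L : AddLineBundle F) {x₀ : L.L} (hx₀ : x₀ ≠ 0) :
    ∃ c : L.L →ₗ[𝓞 F] F, c x₀ = 1 := by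
  classical
  choose s t ht hrep using L.exists_rep hx₀
  have hdiv : ∀ (y : L.L) (s' t' : 𝓞 F), t' ≠ 0 → t' • y = s' • x₀ → (s y : F) / t y = s' / t' :=
    fun y s' t' ht' h' => L.rep_div_eq hx₀ (ht y) ht' (hrep y) h'
  refine ⟨{ toFun := fun y => (s y : F) / t y, map_add' := fun y y' => ?_, map_smul' := fun a y => ?_ }, ?_⟩
  · have hrep' : (t y * t y') • (y + y') = (t y' * s y + t y * s y') • x₀ := by
      rw [smul_add, add_smul, mul_comm (t y) (t y'), mul_smul (t y') (t y) y, hrep y, smul_smul,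
        mul_comm (t y') (t y), mul_smul (t y) (t y') y', hrep y', smul_smul]
    have ht0 : (t y : F) ≠ 0 := fun h0 => ht y (RingOfIntegers.coe_eq_zero_iff.mp h0)
    have ht0' : (t y' : F) ≠ 0 := fun h0 => ht y' (RingOfIntegers.coe_eq_zero_iff.mp h0)
    change (s (y + y') : F) / t (y + y') = (s y : F) / t y + (s y' : F) / t y'
    rw [hdiv (y + y') _ _ (mul_ne_zero (ht y) (ht y')) hrep', div_add_div _ _ ht0 ht0']
    push_cast
    ring
  · have hrep' : t y • (a • y) = (a * s y) • x₀ := by rw [smul_comm, hrep y, mul_smul]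
    change (s (a • y) : F) / t (a • y) = a • ((s y : F) / t y)
    rw [hdiv (a • y) _ _ (ht y) hrep', Algebra.smul_def, RingOfIntegers.coe_eq_algebraMap, map_mul, mul_div_assoc]
  · change (s x₀ : F) / t x₀ = 1
    rw [hdiv x₀ 1 1 one_ne_zero rfl]
    simp

/-- the coordinate is INJECTIVE (`L⊞[⊚]` is torsion-free). [cite: MochizukiAbsTopIII2015, Def 5.3 (ii) p. 123] -/
theorem coordinate_injective (L : AddLineBundle F) {x₀ : L.L} (hx₀ : x₀ ≠ 0) (c : L.L →ₗ[𝓞 F] F)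
    (hc : c x₀ = 1) : Function.Injective c := by
  rw [injective_iff_map_eq_zero]
  intro y hy
  obtain ⟨s, t, ht, h⟩ := L.exists_rep hx₀ y
  have h1 := L.coordinate_apply c hc ht h
  rw [hy, eq_comm, div_eq_zero_iff] at h1
  have hs : s = 0 := by
    rcases h1 with hs | ht0
    · exact RingOfIntegers.coe_eq_zero_iff.mp hs
    · exact absurd (RingOfIntegers.coe_eq_zero_iff.mp ht0) ht
  rw [hs, zero_smul] at h
  exact (smul_eq_zero_iff_right ht).mp h

/-- the coordinate of a NONZERO element is nonzero. [cite: MochizukiAbsTopIII2015, Def 5.3 (ii) p. 123] -/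
theorem coordinate_ne_zero (L : AddLineBundle F) {x₀ : L.L} (hx₀ : x₀ ≠ 0) (c : L.L →ₗ[𝓞 F] F)
    (hc : c x₀ = 1) {y : L.L} (hy : y ≠ 0) : c y ≠ 0 :=
  fun h => hy (L.coordinate_injective hx₀ c hc (by rw [h, map_zero]))

/-- the Hermitian norms SCALE along the coordinate: `|y|_v = |c y|_v · |x₀|_v` (so the norm at `v` is the datum of the
single positive real `|x₀|_v`). [cite: MochizukiAbsTopIII2015, Def 5.3 (ii) p. 123] -/
theorem norm_eq_mul_coordinate (L : AddLineBundle F) {x₀ : L.L} (hx₀ : x₀ ≠ 0) (c : L.L →ₗ[𝓞 F] F)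
    (hc : c x₀ = 1) (v : InfinitePlace F) (y : L.L) : L.norm v y = v (c y) * L.norm v x₀ := by
  obtain ⟨s, t, ht, h⟩ := L.exists_rep hx₀ y
  have ht0 : (t : F) ≠ 0 := fun h0 => ht (RingOfIntegers.coe_eq_zero_iff.mp h0)
  have hvt : v (t : F) ≠ 0 := (map_ne_zero v).mpr ht0
  have h1 : v (t : F) * L.norm v y = v (s : F) * L.norm v x₀ := by
    rw [← L.norm_smul, ← L.norm_smul, h]
  rw [L.coordinate_apply c hc ht h, map_div₀, div_mul_eq_mul_div, eq_div_iff hvt, mul_comm, h1]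

/-- the norm of `x₀` is POSITIVE. [cite: MochizukiAbsTopIII2015, Def 5.3 (ii) p. 123] -/
theorem norm_pos (L : AddLineBundle F) (v : InfinitePlace F) {x : L.L} (hx : x ≠ 0) : 0 < L.norm v x :=
  lt_of_le_of_ne (L.norm_nonneg v x) fun h => hx ((L.norm_eq_zero_iff v x).mp h.symm)

/-- a morphism of `⊞`-line bundles is DETERMINED by its value at one nonzero element.
[cite: MochizukiAbsTopIII2015, Def 5.3 (ii) p. 123] -/
theorem hom_toLinearMap_ext {L₁ L₂ : AddLineBundle F} {x₀ : L₁.L} (hx₀ : x₀ ≠ 0) (f g : Hom L₁ L₂)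
    (h : f.toLinearMap x₀ = g.toLinearMap x₀) : f.toLinearMap = g.toLinearMap := by
  ext y
  obtain ⟨s, t, ht, hrep⟩ := L₁.exists_rep hx₀ y
  have h1 : t • f.toLinearMap y = t • g.toLinearMap y := by
    rw [← map_smul, ← map_smul, hrep, map_smul, map_smul, h]
  exact (smul_right_injective L₂.L ht) h1

/-- two morphisms with the same underlying linear map are equal. [cite: MochizukiAbsTopIII2015, Def 5.3 (ii) p. 123] -/
theorem Hom.ext' {L₁ L₂ : AddLineBundle F} {f g : Hom L₁ L₂} (h : f.toLinearMap = g.toLinearMap) : f = g := by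
  cases f; cases g; cases h; rfl

/-- a morphism MULTIPLIES COORDINATES by the nonzero constant `e := c₂ (f x₁)`: `c₂ (f y) = e · c₁ y`.
[cite: MochizukiAbsTopIII2015, Def 5.3 (ii) p. 123] -/
theorem coordinate_hom {L₁ L₂ : AddLineBundle F} {x₁ : L₁.L} (hx₁ : x₁ ≠ 0) (c₁ : L₁.L →ₗ[𝓞 F] F)
    (hc₁ : c₁ x₁ = 1) (c₂ : L₂.L →ₗ[𝓞 F] F) (f : Hom L₁ L₂) (y : L₁.L) :
    c₂ (f.toLinearMap y) = c₂ (f.toLinearMap x₁) * c₁ y := by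
  obtain ⟨s, t, ht, hrep⟩ := L₁.exists_rep hx₁ y
  have ht0 : (t : F) ≠ 0 := fun h0 => ht (RingOfIntegers.coe_eq_zero_iff.mp h0)
  have h1 : (t : F) * c₂ (f.toLinearMap y) = s * c₂ (f.toLinearMap x₁) := by
    have := congrArg (fun z => c₂ (f.toLinearMap z)) hrep
    simp only [map_smul, Algebra.smul_def] at this
    exact this
  rw [L₁.coordinate_apply c₁ hc₁ ht hrep, mul_div_assoc', eq_div_iff ht0, mul_comm, h1, mul_comm]

/-- the constant of a morphism is NONZERO. [cite: MochizukiAbsTopIII2015, Def 5.3 (ii) p. 123] -/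
theorem coordinate_hom_ne_zero {L₁ L₂ : AddLineBundle F} {x₁ : L₁.L} (hx₁ : x₁ ≠ 0) {x₂ : L₂.L} (hx₂ : x₂ ≠ 0)
    (c₂ : L₂.L →ₗ[𝓞 F] F) (hc₂ : c₂ x₂ = 1) (f : Hom L₁ L₂) : c₂ (f.toLinearMap x₁) ≠ 0 :=
  L₂.coordinate_ne_zero hx₂ c₂ hc₂ fun h => hx₁ (f.injective (by rw [h, map_zero]))

/-- the norm of the image of the base point: `|f x₁|_v = |e|_v · |x₂|_v` with `e` the constant of `f`.
[cite: MochizukiAbsTopIII2015, Def 5.3 (ii) p. 123] -/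
theorem norm_hom_basePoint {L₁ L₂ : AddLineBundle F} {x₂ : L₂.L} (hx₂ : x₂ ≠ 0) (c₂ : L₂.L →ₗ[𝓞 F] F)
    (hc₂ : c₂ x₂ = 1) (f : Hom L₁ L₂) (v : InfinitePlace F) (x₁ : L₁.L) :
    L₂.norm v (f.toLinearMap x₁) = v (c₂ (f.toLinearMap x₁)) * L₂.norm v x₂ :=
  L₂.norm_eq_mul_coordinate hx₂ c₂ hc₂ v _

/-- CONSTRUCTION of a morphism from a constant: if `e ≠ 0` multiplies the coordinate module of `L₁` into that of
`L₂` and contracts the norms (`|e|_v · |x₂|_v ≤ |x₁|_v`), there is a morphism `f` with `c₂ (f x₁) = e`.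
[cite: MochizukiAbsTopIII2015, Def 5.3 (ii) p. 123] -/
theorem exists_hom_of_const {L₁ L₂ : AddLineBundle F} {x₁ : L₁.L} (hx₁ : x₁ ≠ 0) {x₂ : L₂.L} (hx₂ : x₂ ≠ 0)
    (c₁ : L₁.L →ₗ[𝓞 F] F) (hc₁ : c₁ x₁ = 1) (c₂ : L₂.L →ₗ[𝓞 F] F) (hc₂ : c₂ x₂ = 1) {e : F} (he : e ≠ 0)
    (hrange : ∀ y : L₁.L, ∃ z : L₂.L, c₂ z = e * c₁ y)
    (hnorm : ∀ v : InfinitePlace F, v e * L₂.norm v x₂ ≤ L₁.norm v x₁) :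
    ∃ f : Hom L₁ L₂, c₂ (f.toLinearMap x₁) = e := by
  classical
  choose z hz using hrange
  have hinj := L₂.coordinate_injective hx₂ c₂ hc₂
  let g : L₁.L →ₗ[𝓞 F] L₂.L :=
    { toFun := z
      map_add' := fun y y' => hinj (by rw [map_add, hz, hz, hz, map_add, mul_add])
      map_smul' := fun a y => hinj (by
        rw [RingHom.id_apply, map_smul, hz, hz, map_smul, Algebra.smul_def, Algebra.smul_def]
        ring) }
  have hg : ∀ y, c₂ (g y) = e * c₁ y := hz
  refine ⟨⟨g, fun h0 => ?_, fun v y => ?_⟩, by rw [hg, hc₁, mul_one]⟩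
  · have h1 : c₂ (g x₁) = 0 := by rw [h0, LinearMap.zero_apply, map_zero]
    rw [hg, hc₁, mul_one] at h1
    exact he h1
  · rw [L₂.norm_eq_mul_coordinate hx₂ c₂ hc₂ v (g y), hg, map_mul,
      L₁.norm_eq_mul_coordinate hx₁ c₁ hc₁ v y, mul_assoc, mul_left_comm]
    exact mul_le_mul_of_nonneg_left (hnorm v) (apply_nonneg v _)

end AddLineBundle

end Literature.AnabelianGeometry.AbsoluteAnabelian
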